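import Literature.Probability.FitznerVanDerHofstad2017.NobleBlocksPercSupport
import HarnessLib

/-!
# [FvdH17] §6.1 p. 59 / §5.1 p. 49: the AVERAGED double-open element for bond percolation — support of the class-`1` rows and the instantiated bridge

Source: R. Fitzner, R. van der Hofstad, *Mean-field behavior for nearest-neighbor percolation in `d > 10`*,
Electron. J. Probab. **22** (2017) no. 43 [FvdH17]; page / TeX-line locators are those of the extended version
arXiv:1506.07977v2.  §6.1, proof of Lemma 5.2, "Case `a = 1`" (p. 59, TeX l.9885–9887): "`u` and `w` are
neighbors, … `2dD(u−w) = 1`"; App. B, Table "Diagrams and definition of `A^{ι,a,b}(0,v,x,y)`" (p. 75,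
l.10505–10507): the rows `a = 1` carry the factor `2dD(v)`; App. B, display "double-open triangle `Ā^{ι,a,b}`"
(p. 78, l.10595–10601): `Ā^{ι,a,1} = (1/p) A^{ι,a,1}`, `Ā^{ι,1,2}(0,v,x,y) = (1/p) S*_{0,1̲,1̲,0}(v−y,−y,e−y,x−y)`;
§5.1 "Elements of the bounds" (p. 49): the class-`1` entries of `(Ā^ι)_{a,b}` are AVERAGES `(1/2d) Σ_{|u|=1}` over
the unit offsets (the reading typed abstractly in `BlockSummationAvg.matAbarAvg`); §6.1 (6.4)–(6.5) (p. 58);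
Prop. 5.5 (5.34) / Prop. 5.6 (5.37) (p. 53) with §6.2.1 (6.48)–(6.49) (pp. 65–67).

What this module proves (`L = Letters.perc d p`, `U = unitVecs d`, any `d`, any `p`; everything kernel-checked,
NO named fact, no numeral, no statement about dimensions):

* §0 (abstract, namespace `BlockSummation`) — the chain bounds (5.34)/(5.37) with the exit arguments in the order of
  (6.4), `P^{E,b}(t − x, z − x)`: `tsum_le_vecMul_pow_dotProduct'` (printed element `matAbar`) and
  `tsum_le_vecMul_pow_dotProduct_avg'` (averaged element `matAbarAvg`; no `−U = U` hypothesis is needed in this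
  order) — companions of `tsum_le_vecMul_pow_dotProduct` / `tsum_le_vecMul_pow_dotProduct_avg` ((6.51) order).
* (the SUPPORT hypotheses `hAin`/`hAout` — the class-`1` rows of `Ā'`, `Ā'^{*}` vanish off the unit in- and out-offsets —
  are `NobleBlocksPercSupport.perc_blockAbar'_hAin/_hAout`, `perc_blockAbarSt'_hAin/_hAout`, imported.)
* §C — the full left piece `piotaFull L` of the `ι`-summed bound is `W_d`-covariant (`isCov₂_perc_piotaFull`), so
  its gap aggregate and that of every `P^{(N),a}` built over it are constant on `U`
  (`isConstOn_gapSum_perc_piotaFull`, `isConstOn_gapSum_recP_percIotaFull`).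
* §D — THE BRIDGE INSTANTIATED (class selector `avg := fun a => decide (a = 1)` as in `NobleBlocksPercSupport`):
  for `A = blockAbar' L` every hypothesis of the abstract averaged summation except the `x`-space bound `hΞ` is
  discharged by name (`isTransInv_blockAbar'`, `perc_blockAbar'_hAin/_hAout`, `isConstOn_gapSum_perc_blockPS/PE`,
  `isConstOn_gapSum_recP_percFull`, §C, `neg_mem_unitVecs`): generic-`A` forms `…_of` (hypotheses `hA`,
  `hAin`, `hAout` kept, for other elements with class-`1` support), and on `A = blockAbar' L` the `ι`-forms of
  Lemma 5.3 (`perc_invTwoD_mul_sum_tsum_le_vecPiota_matAbarAvg_vecPE`, `perc_tsum_le_vecPiota_matAbarAvg_vecPE_of_symm`,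
  `perc_tsum_ofReal_nobleXiIotaN_le_vecPiota_matAbarAvg_vecPE`), the chain (5.34) in the exit order of (6.4)
  (`perc_tsum_le_vecPS_pow_matAbarAvg_vecPE'`) and the `ι`-summed chain (5.37)
  (`perc_invTwoD_mul_sum_tsum_le_vecPiota_pow_matAbarAvg_vecPE`); the `N = 1` bound (6.5) and the chain (5.34)
  ((6.4) order) also on the starred element `blockAbarSt' L`.  By `matAbarAvg_le_matAbar` each averaged element is
  entrywise below the printed one (`matAbarIota' L`, `matAbarIotaSt' L`).

NOT repeated here (already in `NobleBlocksPercSupport`, same selector): the `N = 1` bound (6.5) with `P⃗^S` on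
`blockAbar'` = `tsum_le_vecPS_matAbarAvg'_vecPE_perc`, and the chain (5.34) in the exit order of (6.51) =
`tsum_le_vecMul_pow_matAbarAvg'_perc`; they are the `A = blockAbar' L` instances of
`perc_tsum_le_vecPS_matAbarAvg_vecPE_of` / `perc_tsum_le_vecPS_pow_matAbarAvg_vecPE_of` below.

ADDITIVE module: nothing in `NobleBlocks`, `NobleBlocksNT`, `NobleBlocksPrime`, `NobleBlocksPercSupport`,
`BlockSummation(Avg)` is modified.
-/

noncomputable section

open scoped BigOperators ENNReal Matrix

/-! ## §0. The chain bounds with the exit arguments in the order of (6.4) -/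

namespace Literature.Probability.FitznerVanDerHofstad2017.BlockSummation

variable {G ι K : Type*} [AddCommGroup G]

/-- **(5.34)/(5.37), exit arguments ordered as in (6.4)** (`P^{E,b}(t − x, z − x)`): if
`Ξ(x) ≤ Σ_{u,w,t,z} Σ_κ Σ_{a,b} P^{(M),a}(u,w) Ā^{κ,a,b}(u,w,t,z) P^{E,b}(t−x,z−x)` for every `x`, with translation
invariant blocks, then `Σ_x Ξ(x) ≤ P⃗S B^M Ā P⃗E`.
[cite: FitznerVanDerHofstad2017, Prop. 5.5 (5.34) and Prop. 5.6 (5.37) (arXiv:1506.07977v2 p. 53); §6.1 (6.4)–(6.5) (p. 58); §6.2.1 (pp. 65–67)] -/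
theorem tsum_le_vecMul_pow_dotProduct' [Fintype ι] [DecidableEq ι] [Fintype K]
    {B A : K → ι → ι → G → G → G → G → ℝ≥0∞} (hB : ∀ κ a b, IsTransInv (B κ a b))
    (hA : ∀ κ a b, IsTransInv (A κ a b)) (Ξ : G → ℝ≥0∞) (PS PE : ι → G → G → ℝ≥0∞) (M : ℕ)
    (hΞ : ∀ x, Ξ x ≤ ∑' u, ∑' w, ∑' t, ∑' z, ∑ κ, ∑ a, ∑ b,
      recP PS B M a u w * A κ a b u w t z * PE b (t - x) (z - x)) :
    ∑' x, Ξ x ≤ vecP PS ᵥ* matB B ^ M ᵥ* matAbar A ⬝ᵥ vecP PE := by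
  calc ∑' x, Ξ x
      ≤ ∑ a, ∑ b, vecP (recP PS B M) a * matAbar A a b * vecP PE b := tsum_le_of_xSpaceBound' hA Ξ _ PE hΞ
    _ ≤ ∑ a, ∑ b, (vecP PS ᵥ* matB B ^ M) a * matAbar A a b * vecP PE b :=
        Finset.sum_le_sum fun a _ => Finset.sum_le_sum fun b _ =>
          mul_le_mul' (mul_le_mul' (vecP_recP_le_vecMul_pow hB PS M a) le_rfl) le_rfl
    _ = vecP PS ᵥ* matB B ^ M ᵥ* matAbar A ⬝ᵥ vecP PE := sum_sum_mul_mul_eq_vecMul_dotProduct _ _ _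

/-- **(5.34)/(5.37) with the AVERAGED terminal element, exit arguments ordered as in (6.4)**: as
`tsum_le_vecMul_pow_dotProduct_avg`, from the `x`-space bound written with `P^{E,b}(t−x,z−x)`; in this order the
right flank enters through `Σ_s P^{E,b}(s, s+y)` and no symmetry of `U` is needed.
[cite: FitznerVanDerHofstad2017, Prop. 5.5 (5.34) and Prop. 5.6 (5.37) (arXiv:1506.07977v2 p. 53); §6.1 (6.4)–(6.5) (p. 58), p. 59; §5.1 p. 49] -/
theorem tsum_le_vecMul_pow_dotProduct_avg' [Fintype ι] [DecidableEq ι] [Fintype K] (U : Finset G)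
    (avg : ι → Bool) {B A : K → ι → ι → G → G → G → G → ℝ≥0∞} (hB : ∀ κ a b, IsTransInv (B κ a b))
    (hA : ∀ κ a b, IsTransInv (A κ a b))
    (hAin : ∀ κ a b, avg a = true → ∀ v x y, v ∉ U → A κ a b 0 v x y = 0)
    (hAout : ∀ κ a b, avg b = true → ∀ v x y, y - x ∉ U → A κ a b 0 v x y = 0)
    (Ξ : G → ℝ≥0∞) (PS PE : ι → G → G → ℝ≥0∞) (M : ℕ)
    (hPM : ∀ a, avg a = true → IsConstOn U (gapSum (recP PS B M a)))
    (hPE : ∀ b, avg b = true → IsConstOn U (gapSum (PE b)))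
    (hΞ : ∀ x, Ξ x ≤ ∑' u, ∑' w, ∑' t, ∑' z, ∑ κ, ∑ a, ∑ b,
      recP PS B M a u w * A κ a b u w t z * PE b (t - x) (z - x)) :
    ∑' x, Ξ x ≤ vecP PS ᵥ* matB B ^ M ᵥ* matAbarAvg U avg A ⬝ᵥ vecP PE := by
  calc ∑' x, Ξ x
      ≤ ∑ a, ∑ b, vecP (recP PS B M) a * matAbarAvg U avg A a b * vecP PE b :=
        tsum_le_of_xSpaceBound_avg' U avg hA hAin hAout Ξ _ PE hPM hPE hΞ
    _ ≤ ∑ a, ∑ b, (vecP PS ᵥ* matB B ^ M) a * matAbarAvg U avg A a b * vecP PE b :=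
        Finset.sum_le_sum fun a _ => Finset.sum_le_sum fun b _ =>
          mul_le_mul' (mul_le_mul' (vecP_recP_le_vecMul_pow hB PS M a) le_rfl) le_rfl
    _ = vecP PS ᵥ* matB B ^ M ᵥ* matAbarAvg U avg A ⬝ᵥ vecP PE :=
        sum_sum_mul_mul_eq_vecMul_dotProduct _ _ _

end Literature.Probability.FitznerVanDerHofstad2017.BlockSummation

namespace Literature.Probability.FitznerVanDerHofstad2017.NobleBlocks

open _root_.MeasureTheory Literature.Probability.LatticeModels Literature.Probability.Percolation
open Literature.Probability.FitznerVanDerHofstad2017.BlockSummation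
open Literature.Barriers.CriticalPhenomena (measure_not_subset_edgeSet nobleXiIotaN)

variable {d : ℕ} (p : unitInterval)

local notation "𝐞" => Literature.Probability.Percolation.stepVec
local notation "𝐋" => Letters.perc d p

/-! ## §C. The full left piece of the `ι`-summed bound is `W_d`-covariant -/

section IotaFull

/-- The trivial initial piece `δ_{0,a} 𝟙{u=0} 𝟙{w=0}` is `W_d`-covariant (`σ0 = 0`). [folklore] -/
theorem isCov₂_trivPiece (a : Fin 3) : IsCov₂ (signedPermAddEquivs d) (trivPiece (d := d) a) :=
  isCov₂_signedPermAddEquivs_iff.2 fun π ε u w => by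
    simp only [trivPiece, kd, eq_comm (a := (0 : Site d)), signedPerm_eq_zero_iff]

/-- **The full left piece `δ_{0,a} 𝟙{u=w=0} + Σ_ι P^{ι,a}(u,w)` is `W_d`-covariant** (percolation).
[cite: FitznerVanDerHofstad2017, §6.1 (6.x) (arXiv:1506.07977v2 p. 59); §3.5 (p. 32); App. B Table "P^{ι,b}" (p. 73)] -/
theorem isCov₂_perc_piotaFull (a : Fin 3) : IsCov₂ (signedPermAddEquivs d) (piotaFull 𝐋 a) :=
  isCov₂_signedPermAddEquivs_iff.2 fun π ε u w => by
    rw [piotaFull, piotaFull, isCov₂_signedPermAddEquivs_iff.1 (isCov₂_trivPiece a) π ε u w,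
      sum_perc_blockPiota_signedPerm p π ε a u w]

/-- The gap aggregate of the full left piece is the same for all unit offsets (hypothesis `hL` of
`tsum_le_vecMul_matAbarAvg_dotProduct'` with `L = piotaFull`). [cite: FitznerVanDerHofstad2017, §6.1 p. 59 ("u and w are neighbors") (arXiv:1506.07977v2)] -/
theorem isConstOn_gapSum_perc_piotaFull (a : Fin 3) : IsConstOn (unitVecs d) (gapSum (piotaFull 𝐋 a)) :=
  isConstOn_gapSum_of_cov _ _ signedPermAddEquivs_transitive (isCov₂_perc_piotaFull p a)

/-- **Left flank of the `ι`-summed chain**: the gap aggregate of every `P^{(N),a}` (6.48)–(6.49) built over the full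
left piece `piotaFull L` and the full closed blocks is constant on the unit vectors (hypothesis `hPM`).
[cite: FitznerVanDerHofstad2017, §6.2.1 (6.48)–(6.49) (arXiv:1506.07977v2 p. 65); §6.1 p. 59] -/
theorem isConstOn_gapSum_recP_percIotaFull (N : ℕ) (a : Fin 3) :
    IsConstOn (unitVecs d) (gapSum (recP (piotaFull 𝐋) (blockBFull 𝐋) N a)) :=
  isConstOn_gapSum_recP _ _ signedPermAddEquivs_transitive _ (isCov₂_perc_piotaFull p) _
    (isCov₄_sum_perc_blockBFull p) N a

end IotaFull

/-! ## §D. The averaging bridge instantiated for bond percolation -/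

section Bridge

/-! Throughout, the class selector is `avg := fun a : Fin 3 => decide (a = 1)` (class `1̲` averaged on both sides, as in
`NobleBlocksPercSupport`), written out in every statement. -/

/-! ### Generic in the double-open family `A` (support hypotheses kept) -/

/-- **(6.5) with an averaged element, percolation pieces, generic `A`**: `Σ_x Ξ(x) ≤ P⃗^S (Ā_avg) P⃗^E`.
[cite: FitznerVanDerHofstad2017, §6.1 (6.4)–(6.5) (arXiv:1506.07977v2 p. 58), p. 59; §5.1 p. 49] -/
theorem perc_tsum_le_vecPS_matAbarAvg_vecPE_of {A : DirBlockFamily d} (hA : ∀ κ a b, IsTransInv (A κ a b))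
    (hAin : ∀ κ a b, decide (a = 1) = true → ∀ v x y, v ∉ unitVecs d → A κ a b 0 v x y = 0)
    (hAout : ∀ κ a b, decide (b = 1) = true → ∀ v x y, y - x ∉ unitVecs d → A κ a b 0 v x y = 0)
    (Ξ : Site d → ℝ≥0∞)
    (hΞ : ∀ x, Ξ x ≤ ∑' u, ∑' w, ∑' t, ∑' z, ∑ κ : Fin d × Bool, ∑ a : Fin 3, ∑ b : Fin 3,
      blockPS 𝐋 a u w * A κ a b u w t z * blockPE 𝐋 b (t - x) (z - x)) :
    ∑' x, Ξ x ≤ vecPS 𝐋 ᵥ* matAbarAvg (unitVecs d) (fun a : Fin 3 => decide (a = 1)) A ⬝ᵥ vecPE 𝐋 :=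
  tsum_le_vecMul_matAbarAvg_dotProduct' (unitVecs d) (fun a : Fin 3 => decide (a = 1)) hA hAin hAout Ξ (blockPS 𝐋) (blockPE 𝐋)
    (fun a _ => isConstOn_gapSum_perc_blockPS p a) (fun b _ => isConstOn_gapSum_perc_blockPE p b) hΞ

/-- **(BoundXiIotaOne-1), `ι`-averaged with the trivial term, averaged element, generic `A`**:
`(1/2d) Σ_ι Σ_x Ξ^ι(x) ≤ P⃗^ι (Ā_avg) P⃗^E`. [cite: FitznerVanDerHofstad2017, Lemma 5.3 (BoundXiIotaOne-1) (arXiv:1506.07977v2 p. 50); §6.1 (6.x) (p. 59); §5.1 p. 49] -/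
theorem perc_invTwoD_mul_sum_tsum_le_vecPiota_matAbarAvg_vecPE_of {A : DirBlockFamily d}
    (hA : ∀ κ a b, IsTransInv (A κ a b))
    (hAin : ∀ κ a b, decide (a = 1) = true → ∀ v x y, v ∉ unitVecs d → A κ a b 0 v x y = 0)
    (hAout : ∀ κ a b, decide (b = 1) = true → ∀ v x y, y - x ∉ unitVecs d → A κ a b 0 v x y = 0)
    (Ξι : Fin d × Bool → Site d → ℝ≥0∞)
    (hΞ : ∀ ι x, Ξι ι x ≤ ∑' u, ∑' w, ∑' t, ∑' z, ∑ κ : Fin d × Bool, ∑ a : Fin 3, ∑ b : Fin 3,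
      (kdeltaPref ι κ a u w + blockPiota 𝐋 ι a u w) * A κ a b u w t z * blockPE 𝐋 b (t - x) (z - x)) :
    invTwoD d * ∑ ι : Fin d × Bool, ∑' x, Ξι ι x ≤ vecPiota 𝐋 ᵥ* matAbarAvg (unitVecs d) (fun a : Fin 3 => decide (a = 1)) A ⬝ᵥ vecPE 𝐋 := by
  have h2 : ∑' x, ∑ ι : Fin d × Bool, Ξι ι x ≤ vecP (piotaFull 𝐋) ᵥ* matAbarAvg (unitVecs d) (fun a : Fin 3 => decide (a = 1)) A ⬝ᵥ vecPE 𝐋 :=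
    tsum_le_vecMul_matAbarAvg_dotProduct' (unitVecs d) (fun a : Fin 3 => decide (a = 1)) hA hAin hAout (fun x => ∑ ι : Fin d × Bool, Ξι ι x)
      (piotaFull 𝐋) (blockPE 𝐋) (fun a _ => isConstOn_gapSum_perc_piotaFull p a)
      (fun b _ => isConstOn_gapSum_perc_blockPE p b) (sum_le_xSpaceBound_piotaFull_of 𝐋 A Ξι hΞ)
  rw [← tsum_finsetSum, ← invTwoD_mul_vecP_piotaFull_vecMul_dotProduct 𝐋 (matAbarAvg (unitVecs d) (fun a : Fin 3 => decide (a = 1)) A) (vecPE 𝐋)]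
  gcongr

/-- **(BoundXiIotaOne-1), fixed direction under symmetry, averaged element, generic `A`.**
[cite: FitznerVanDerHofstad2017, Lemma 5.3 (BoundXiIotaOne-1) (arXiv:1506.07977v2 p. 50); §6.1 (p. 59); §3.5 (p. 30)] -/
theorem perc_tsum_le_vecPiota_matAbarAvg_vecPE_of_symm_of {A : DirBlockFamily d}
    (hA : ∀ κ a b, IsTransInv (A κ a b))
    (hAin : ∀ κ a b, decide (a = 1) = true → ∀ v x y, v ∉ unitVecs d → A κ a b 0 v x y = 0)
    (hAout : ∀ κ a b, decide (b = 1) = true → ∀ v x y, y - x ∉ unitVecs d → A κ a b 0 v x y = 0)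
    (Ξι : Fin d × Bool → Site d → ℝ≥0∞)
    (hΞ : ∀ ι x, Ξι ι x ≤ ∑' u, ∑' w, ∑' t, ∑' z, ∑ κ : Fin d × Bool, ∑ a : Fin 3, ∑ b : Fin 3,
      (kdeltaPref ι κ a u w + blockPiota 𝐋 ι a u w) * A κ a b u w t z * blockPE 𝐋 b (t - x) (z - x))
    (ι₀ : Fin d × Bool) (hsym : ∀ ι, ∑' x, Ξι ι x = ∑' x, Ξι ι₀ x) :
    ∑' x, Ξι ι₀ x ≤ vecPiota 𝐋 ᵥ* matAbarAvg (unitVecs d) (fun a : Fin 3 => decide (a = 1)) A ⬝ᵥ vecPE 𝐋 := by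
  have hd : d ≠ 0 := Nat.pos_iff_ne_zero.1 ι₀.1.pos
  have h := perc_invTwoD_mul_sum_tsum_le_vecPiota_matAbarAvg_vecPE_of p hA hAin hAout Ξι hΞ
  simp_rw [hsym, Finset.sum_const, Finset.card_univ, nsmul_eq_mul] at h
  rwa [invTwoD_mul_card_mul hd] at h

/-- **(5.34) with an averaged terminal element, percolation pieces, generic `A`, exit order (6.4)**:
`Σ_x Ξ(x) ≤ P⃗^S B^M (Ā_avg) P⃗^E`. [cite: FitznerVanDerHofstad2017, Prop. 5.5 (5.34) (arXiv:1506.07977v2 p. 53); §6.2.1 (6.48)–(6.49) (p. 65); §6.1 p. 59] -/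
theorem perc_tsum_le_vecPS_pow_matAbarAvg_vecPE_of' {A : DirBlockFamily d} (hA : ∀ κ a b, IsTransInv (A κ a b))
    (hAin : ∀ κ a b, decide (a = 1) = true → ∀ v x y, v ∉ unitVecs d → A κ a b 0 v x y = 0)
    (hAout : ∀ κ a b, decide (b = 1) = true → ∀ v x y, y - x ∉ unitVecs d → A κ a b 0 v x y = 0)
    (Ξ : Site d → ℝ≥0∞) (M : ℕ)
    (hΞ : ∀ x, Ξ x ≤ ∑' u, ∑' w, ∑' t, ∑' z, ∑ κ : Fin d × Bool, ∑ a : Fin 3, ∑ b : Fin 3,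
      recP (blockPS 𝐋) (blockBFull 𝐋) M a u w * A κ a b u w t z * blockPE 𝐋 b (t - x) (z - x)) :
    ∑' x, Ξ x ≤ vecPS 𝐋 ᵥ* matB (blockBFull 𝐋) ^ M ᵥ* matAbarAvg (unitVecs d) (fun a : Fin 3 => decide (a = 1)) A ⬝ᵥ vecPE 𝐋 :=
  tsum_le_vecMul_pow_dotProduct_avg' (unitVecs d) (fun a : Fin 3 => decide (a = 1)) (isTransInv_blockBFull 𝐋) hA hAin hAout Ξ (blockPS 𝐋)
    (blockPE 𝐋) M (fun a _ => isConstOn_gapSum_recP_percFull p M a) (fun b _ => isConstOn_gapSum_perc_blockPE p b) hΞ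

/-- **(5.34) with an averaged terminal element, percolation pieces, generic `A`, exit order (6.51)**
(`P^{E,b}(z − x, t − x)`; uses `−U = U` for the unit vectors). [cite: FitznerVanDerHofstad2017, Prop. 5.5 (5.34) (arXiv:1506.07977v2 p. 53); Lemma 6.1 (6.51) (p. 66); §6.1 p. 59] -/
theorem perc_tsum_le_vecPS_pow_matAbarAvg_vecPE_of {A : DirBlockFamily d} (hA : ∀ κ a b, IsTransInv (A κ a b))
    (hAin : ∀ κ a b, decide (a = 1) = true → ∀ v x y, v ∉ unitVecs d → A κ a b 0 v x y = 0)
    (hAout : ∀ κ a b, decide (b = 1) = true → ∀ v x y, y - x ∉ unitVecs d → A κ a b 0 v x y = 0)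
    (Ξ : Site d → ℝ≥0∞) (M : ℕ)
    (hΞ : ∀ x, Ξ x ≤ ∑' u, ∑' w, ∑' t, ∑' z, ∑ κ : Fin d × Bool, ∑ a : Fin 3, ∑ b : Fin 3,
      recP (blockPS 𝐋) (blockBFull 𝐋) M a u w * A κ a b u w t z * blockPE 𝐋 b (z - x) (t - x)) :
    ∑' x, Ξ x ≤ vecPS 𝐋 ᵥ* matB (blockBFull 𝐋) ^ M ᵥ* matAbarAvg (unitVecs d) (fun a : Fin 3 => decide (a = 1)) A ⬝ᵥ vecPE 𝐋 :=
  tsum_le_vecMul_pow_dotProduct_avg (unitVecs d) (fun _ hv => neg_mem_unitVecs hv) (fun a : Fin 3 => decide (a = 1)) (isTransInv_blockBFull 𝐋)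
    hA hAin hAout Ξ (blockPS 𝐋) (blockPE 𝐋) M (fun a _ => isConstOn_gapSum_recP_percFull p M a)
    (fun b _ => isConstOn_gapSum_perc_blockPE p b) hΞ

/-- **(5.37), `ι`-summed with the trivial term, averaged terminal element, generic `A`, exit order (6.4)**: if the
`ι`-summed `x`-space chain bound holds with the left pieces `P^{(M),a}` built over `piotaFull L`, then
`(1/2d) Σ_ι Σ_x Ξ^ι(x) ≤ P⃗^ι B^M (Ā_avg) P⃗^E`. [cite: FitznerVanDerHofstad2017, Prop. 5.6 (5.37) (arXiv:1506.07977v2 p. 53); §6.2.1 (pp. 65–67); §6.1 (6.x) (p. 59); §5.1 `(P⃗^ι)_b` (p. 49)] -/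
theorem perc_invTwoD_mul_sum_tsum_le_vecPiota_pow_matAbarAvg_vecPE_of {A : DirBlockFamily d}
    (hA : ∀ κ a b, IsTransInv (A κ a b))
    (hAin : ∀ κ a b, decide (a = 1) = true → ∀ v x y, v ∉ unitVecs d → A κ a b 0 v x y = 0)
    (hAout : ∀ κ a b, decide (b = 1) = true → ∀ v x y, y - x ∉ unitVecs d → A κ a b 0 v x y = 0)
    (Ξι : Fin d × Bool → Site d → ℝ≥0∞) (M : ℕ)
    (hΞ : ∀ x, ∑ ι : Fin d × Bool, Ξι ι x ≤ ∑' u, ∑' w, ∑' t, ∑' z, ∑ κ : Fin d × Bool, ∑ a : Fin 3, ∑ b : Fin 3,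
      recP (piotaFull 𝐋) (blockBFull 𝐋) M a u w * A κ a b u w t z * blockPE 𝐋 b (t - x) (z - x)) :
    invTwoD d * ∑ ι : Fin d × Bool, ∑' x, Ξι ι x ≤
      vecPiota 𝐋 ᵥ* (matB (blockBFull 𝐋) ^ M * matAbarAvg (unitVecs d) (fun a : Fin 3 => decide (a = 1)) A) ⬝ᵥ vecPE 𝐋 := by
  have h2 : ∑' x, ∑ ι : Fin d × Bool, Ξι ι x ≤
      vecP (piotaFull 𝐋) ᵥ* matB (blockBFull 𝐋) ^ M ᵥ* matAbarAvg (unitVecs d) (fun a : Fin 3 => decide (a = 1)) A ⬝ᵥ vecPE 𝐋 :=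
    tsum_le_vecMul_pow_dotProduct_avg' (unitVecs d) (fun a : Fin 3 => decide (a = 1)) (isTransInv_blockBFull 𝐋) hA hAin hAout
      (fun x => ∑ ι : Fin d × Bool, Ξι ι x) (piotaFull 𝐋) (blockPE 𝐋) M
      (fun a _ => isConstOn_gapSum_recP_percIotaFull p M a) (fun b _ => isConstOn_gapSum_perc_blockPE p b) hΞ
  rw [Matrix.vecMul_vecMul] at h2
  rw [← tsum_finsetSum, ← invTwoD_mul_vecP_piotaFull_vecMul_dotProduct 𝐋 _ (vecPE 𝐋)]
  gcongr

/-! ### The element `A = Ā'` (`blockAbar' L`): every hypothesis but `hΞ` discharged -/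


/-- **(BoundXiIotaOne-1) for bond percolation, `ι`-averaged with the trivial term, averaged element `(Ā^ι)'_avg`.**
[cite: FitznerVanDerHofstad2017, Lemma 5.3 (BoundXiIotaOne-1) (arXiv:1506.07977v2 p. 50); §6.1 (6.x) (p. 59); §5.1 p. 49] -/
theorem perc_invTwoD_mul_sum_tsum_le_vecPiota_matAbarAvg_vecPE (Ξι : Fin d × Bool → Site d → ℝ≥0∞)
    (hΞ : ∀ ι x, Ξι ι x ≤ ∑' u, ∑' w, ∑' t, ∑' z, ∑ κ : Fin d × Bool, ∑ a : Fin 3, ∑ b : Fin 3,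
      (kdeltaPref ι κ a u w + blockPiota 𝐋 ι a u w) * blockAbar' 𝐋 κ a b u w t z * blockPE 𝐋 b (t - x) (z - x)) :
    invTwoD d * ∑ ι : Fin d × Bool, ∑' x, Ξι ι x ≤
      vecPiota 𝐋 ᵥ* matAbarAvg (unitVecs d) (fun a : Fin 3 => decide (a = 1)) (blockAbar' 𝐋) ⬝ᵥ vecPE 𝐋 :=
  perc_invTwoD_mul_sum_tsum_le_vecPiota_matAbarAvg_vecPE_of p (isTransInv_blockAbar' 𝐋)
    (perc_blockAbar'_hAin p) (perc_blockAbar'_hAout p) Ξι hΞ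

/-- **(BoundXiIotaOne-1) for bond percolation, fixed direction under symmetry, averaged element `(Ā^ι)'_avg`.**
[cite: FitznerVanDerHofstad2017, Lemma 5.3 (BoundXiIotaOne-1) (arXiv:1506.07977v2 p. 50); §6.1 (p. 59); §3.5 (p. 30)] -/
theorem perc_tsum_le_vecPiota_matAbarAvg_vecPE_of_symm (Ξι : Fin d × Bool → Site d → ℝ≥0∞)
    (hΞ : ∀ ι x, Ξι ι x ≤ ∑' u, ∑' w, ∑' t, ∑' z, ∑ κ : Fin d × Bool, ∑ a : Fin 3, ∑ b : Fin 3,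
      (kdeltaPref ι κ a u w + blockPiota 𝐋 ι a u w) * blockAbar' 𝐋 κ a b u w t z * blockPE 𝐋 b (t - x) (z - x))
    (ι₀ : Fin d × Bool) (hsym : ∀ ι, ∑' x, Ξι ι x = ∑' x, Ξι ι₀ x) :
    ∑' x, Ξι ι₀ x ≤ vecPiota 𝐋 ᵥ* matAbarAvg (unitVecs d) (fun a : Fin 3 => decide (a = 1)) (blockAbar' 𝐋) ⬝ᵥ vecPE 𝐋 :=
  perc_tsum_le_vecPiota_matAbarAvg_vecPE_of_symm_of p (isTransInv_blockAbar' 𝐋) (perc_blockAbar'_hAin p)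
    (perc_blockAbar'_hAout p) Ξι hΞ ι₀ hsym

/-- **(BoundXiIotaOne-1) for `Ξ^{(N),ι}_p` with the averaged element `(Ā^ι)'_avg`**: if `Ξ^{(N),ι}_p` obeys (6.x)
with `blockAbar'` for every `ι`, then `Σ_x Ξ^{(N),ι₀}_p(x) ≤ P⃗^ι (Ā'_avg) P⃗^E` for every `ι₀`.
[cite: FitznerVanDerHofstad2017, Lemma 5.3 (BoundXiIotaOne-1) (arXiv:1506.07977v2 p. 50); §6.1 (6.x) (p. 59); §3.5 (p. 30)] -/
theorem perc_tsum_ofReal_nobleXiIotaN_le_vecPiota_matAbarAvg_vecPE (N : ℕ)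
    (hΞ : ∀ ι x, ENNReal.ofReal (nobleXiIotaN d p (𝐞 ι) N x)
      ≤ ∑' u, ∑' w, ∑' t, ∑' z, ∑ κ : Fin d × Bool, ∑ a : Fin 3, ∑ b : Fin 3,
        (kdeltaPref ι κ a u w + blockPiota 𝐋 ι a u w) * blockAbar' 𝐋 κ a b u w t z * blockPE 𝐋 b (t - x) (z - x))
    (ι₀ : Fin d × Bool) :
    ∑' x, ENNReal.ofReal (nobleXiIotaN d p (𝐞 ι₀) N x) ≤
      vecPiota 𝐋 ᵥ* matAbarAvg (unitVecs d) (fun a : Fin 3 => decide (a = 1)) (blockAbar' 𝐋) ⬝ᵥ vecPE 𝐋 :=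
  perc_tsum_le_vecPiota_matAbarAvg_vecPE_of_symm p (fun ι x => ENNReal.ofReal (nobleXiIotaN d p (𝐞 ι) N x))
    hΞ ι₀ fun ι => tsum_ofReal_nobleXiIotaN_exch p N ι ι₀

/-- **[FvdH17] (5.34) for bond percolation with the averaged terminal element `(Ā^ι)'_avg`, exit order (6.4)**:
the chain `x`-space bound with `P^{(M)}` over `P^S` and the full closed blocks sums to
`Σ_x Ξ(x) ≤ P⃗^S B^M (Ā'_avg) P⃗^E`. [cite: FitznerVanDerHofstad2017, Prop. 5.5 (5.34) (arXiv:1506.07977v2 p. 53); §6.2.1 (pp. 65–67); §6.1 p. 59; §5.1 p. 49] -/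
theorem perc_tsum_le_vecPS_pow_matAbarAvg_vecPE' (Ξ : Site d → ℝ≥0∞) (M : ℕ)
    (hΞ : ∀ x, Ξ x ≤ ∑' u, ∑' w, ∑' t, ∑' z, ∑ κ : Fin d × Bool, ∑ a : Fin 3, ∑ b : Fin 3,
      recP (blockPS 𝐋) (blockBFull 𝐋) M a u w * blockAbar' 𝐋 κ a b u w t z * blockPE 𝐋 b (t - x) (z - x)) :
    ∑' x, Ξ x ≤ vecPS 𝐋 ᵥ* matB (blockBFull 𝐋) ^ M ᵥ* matAbarAvg (unitVecs d) (fun a : Fin 3 => decide (a = 1)) (blockAbar' 𝐋) ⬝ᵥ vecPE 𝐋 :=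
  perc_tsum_le_vecPS_pow_matAbarAvg_vecPE_of' p (isTransInv_blockAbar' 𝐋) (perc_blockAbar'_hAin p)
    (perc_blockAbar'_hAout p) Ξ M hΞ

/-- **[FvdH17] (5.37) for bond percolation, `ι`-summed with the trivial term, averaged terminal element `(Ā^ι)'_avg`.**
[cite: FitznerVanDerHofstad2017, Prop. 5.6 (5.37) (arXiv:1506.07977v2 p. 53); §6.2.1 (pp. 65–67); §6.1 (6.x) (p. 59); §5.1 p. 49] -/
theorem perc_invTwoD_mul_sum_tsum_le_vecPiota_pow_matAbarAvg_vecPE (Ξι : Fin d × Bool → Site d → ℝ≥0∞) (M : ℕ)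
    (hΞ : ∀ x, ∑ ι : Fin d × Bool, Ξι ι x ≤ ∑' u, ∑' w, ∑' t, ∑' z, ∑ κ : Fin d × Bool, ∑ a : Fin 3, ∑ b : Fin 3,
      recP (piotaFull 𝐋) (blockBFull 𝐋) M a u w * blockAbar' 𝐋 κ a b u w t z * blockPE 𝐋 b (t - x) (z - x)) :
    invTwoD d * ∑ ι : Fin d × Bool, ∑' x, Ξι ι x ≤
      vecPiota 𝐋 ᵥ* (matB (blockBFull 𝐋) ^ M * matAbarAvg (unitVecs d) (fun a : Fin 3 => decide (a = 1)) (blockAbar' 𝐋)) ⬝ᵥ vecPE 𝐋 :=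
  perc_invTwoD_mul_sum_tsum_le_vecPiota_pow_matAbarAvg_vecPE_of p (isTransInv_blockAbar' 𝐋)
    (perc_blockAbar'_hAin p) (perc_blockAbar'_hAout p) Ξι M hΞ

/-! ### The starred element `A = Ā'^{*}` (`blockAbarSt' L`) -/

/-- (6.5) for bond percolation with the averaged starred element `(Ā^{ι,*})'_avg`.
[cite: FitznerVanDerHofstad2017, §6.1 (6.4)–(6.5) (arXiv:1506.07977v2 p. 58), p. 59; §5.1 pp. 47, 49] -/
theorem perc_tsum_le_vecPS_matAbarStAvg_vecPE (Ξ : Site d → ℝ≥0∞)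
    (hΞ : ∀ x, Ξ x ≤ ∑' u, ∑' w, ∑' t, ∑' z, ∑ κ : Fin d × Bool, ∑ a : Fin 3, ∑ b : Fin 3,
      blockPS 𝐋 a u w * blockAbarSt' 𝐋 κ a b u w t z * blockPE 𝐋 b (t - x) (z - x)) :
    ∑' x, Ξ x ≤ vecPS 𝐋 ᵥ* matAbarAvg (unitVecs d) (fun a : Fin 3 => decide (a = 1)) (blockAbarSt' 𝐋) ⬝ᵥ vecPE 𝐋 :=
  perc_tsum_le_vecPS_matAbarAvg_vecPE_of p (isTransInv_blockAbarSt' 𝐋) (perc_blockAbarSt'_hAin p)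
    (perc_blockAbarSt'_hAout p) Ξ hΞ

/-- (5.34) for bond percolation with the averaged starred terminal element `(Ā^{ι,*})'_avg`, exit order (6.4).
[cite: FitznerVanDerHofstad2017, Prop. 5.5 (5.34) (arXiv:1506.07977v2 p. 53); §6.2.1 (pp. 65–67); §6.1 p. 59; §5.1 pp. 47, 49] -/
theorem perc_tsum_le_vecPS_pow_matAbarStAvg_vecPE' (Ξ : Site d → ℝ≥0∞) (M : ℕ)
    (hΞ : ∀ x, Ξ x ≤ ∑' u, ∑' w, ∑' t, ∑' z, ∑ κ : Fin d × Bool, ∑ a : Fin 3, ∑ b : Fin 3,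
      recP (blockPS 𝐋) (blockBFull 𝐋) M a u w * blockAbarSt' 𝐋 κ a b u w t z * blockPE 𝐋 b (t - x) (z - x)) :
    ∑' x, Ξ x ≤
      vecPS 𝐋 ᵥ* matB (blockBFull 𝐋) ^ M ᵥ* matAbarAvg (unitVecs d) (fun a : Fin 3 => decide (a = 1)) (blockAbarSt' 𝐋) ⬝ᵥ vecPE 𝐋 :=
  perc_tsum_le_vecPS_pow_matAbarAvg_vecPE_of' p (isTransInv_blockAbarSt' 𝐋) (perc_blockAbarSt'_hAin p)
    (perc_blockAbarSt'_hAout p) Ξ M hΞ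

/-! ### Averaged ≤ printed -/

/-- The averaged primed element is entrywise below the printed primed element `(Ā^ι)' = matAbarIota' L`.
[cite: FitznerVanDerHofstad2017, §5.1 "Elements of the bounds" (arXiv:1506.07977v2 p. 49)] -/
theorem matAbarAvg_blockAbar'_le_matAbarIota' (L : Letters d) (a b : Fin 3) :
    matAbarAvg (unitVecs d) (fun a : Fin 3 => decide (a = 1)) (blockAbar' L) a b ≤ matAbarIota' L a b :=
  matAbarAvg_le_matAbar (unitVecs d) _ (blockAbar' L) a b

/-- The averaged starred primed element is entrywise below `(Ā^{ι,*})' = matAbarIotaSt' L`.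
[cite: FitznerVanDerHofstad2017, §5.1 "Elements of the bounds" (arXiv:1506.07977v2 p. 49)] -/
theorem matAbarAvg_blockAbarSt'_le_matAbarIotaSt' (L : Letters d) (a b : Fin 3) :
    matAbarAvg (unitVecs d) (fun a : Fin 3 => decide (a = 1)) (blockAbarSt' L) a b ≤ matAbarIotaSt' L a b :=
  matAbarAvg_le_matAbar (unitVecs d) _ (blockAbarSt' L) a b

end Bridge

end Literature.Probability.FitznerVanDerHofstad2017.NobleBlocks

end
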